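import Literature.NumberTheory.EllipticCurves.ModularPolynomialLevelSevenFibreZero
import Literature.NumberTheory.EllipticCurves.ClassPolynomialNegThirtyFive
import Literature.NumberTheory.EllipticCurves.ClassPolynomialNegOneHundredTwelve
import Literature.NumberTheory.EllipticCurves.GrossZagierSingularModuliClassNumberOne
import HarnessLib

/-!
# Nine CM relations `Φ₇(x₀, y₀) = 0` for the modular equation of level 7 (discriminants `−7, −12, −19, −27, −28, −35, −112`)

certified instances and evidence bearing on the general Hodge conjecture; no claim.

Topic `NumberTheory/EllipticCurves` (complex multiplication).  Theorem-only file (no definition, no named fact; D-0026),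
sequel to `ModularPolynomialLevelSevenFibreZero.lean` (the level-7 point movers `divPoint_seven_heegnerTau_of_pos`,
`heegnerTau_seven_mul`), in the tree's vocabulary `intModularPolynomial 7`, `heegnerTau`, `formJ`, `divPoint 7 k`;
`Fact (Nat.Prime 7)` is an instance ARGUMENT throughout.  Level-7 counterpart of `ModularPolynomialLevelFivePoints.lean` (anchor of
the level-5 series), restricted to the bases whose relation is a SIMPLE consequence of one coset: the class-number-one discriminants
in which `7` splits or ramifies and the two class-number-two discriminants of the tree in which `7` ramifies with a non-principal
prime.  (The split class-number-two bases `−20, −24, −40, −48, −52, −75, −115`, where two cosets coincide and the fibre acquires a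
DOUBLE root, are left to a sequel.)

## PRINTED inputs
* `Φ_m(j(στ), j(τ)) = 0` for `σ ∈ C(m)` [Cox2013, §11.B (11.15) and the remark after it, PDF p. 239] (tree:
  `intModularPolynomial_kleinJ_divPoint`), `σ_k τ = (τ + k)/7 ↔` the index-7 sublattice `7[1, σ_k τ]` [Cox2013, §11.B Lemma 11.24];
* `j(τ_Q)` depends only on the proper equivalence class of `Q` [Cox2013, §11.A Thm. 11.2] (tree: `formJ_eq_formJ_act`);
* the singular moduli `j = −3375, 54000, −884736, −12288000, 16581375` for `D = −7, −12, −19, −27, −28` [Cox2013, §12.C table (12.20)]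
  (tree theorems `GrossZagier1985.kleinJ_heegnerTau_neg_seven/…/neg_twentyEight`, USED BY NAME), and the class-number-two values of the tree files `ClassPolynomialNegThirtyFive/NegOneHundredTwelve.lean` (`formJ_eq`, `formJ_other_eq`).

## Results (OURS: the choice of sublattices and the reductions; each a kernel-checked consequence of the printed inputs)
For each CM point `τ_Q` below, ONE level-7 conjugate `(τ_Q + k)/7` is the Heegner point of an invertible `𝒪_D`-ideal of norm 7
(as a form: `7·Q'` with `Q' ~ Q` or `Q'` in the other class), giving `Φ₇(j(τ_{Q'}), j(τ_Q)) = 0` between moduli the tree knows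
exactly (§1: `conj_k_negD`; §2: `rel_negD` with the moduli as atoms `formJ Q`; §3: `rel_negD_explicit` with the printed values):
* `D = −12, −19, −27` (class number one, `7` split: `7 = N(2+√−3) = N((1+√−19)/2 + 1) = …`) and `D = −7, −28` (`7` ramified,
  `(√−7)` principal): the diagonal zeros `Φ₇(j, j) = 0` at `j = 54000, −884736, −12288000, −3375, 16581375`; for the split ones BOTH
  cosets `k` with `(τ+k)/7 ~ τ` are recorded (`−12`: `k = 2, 5`; `−19`: `k = 2, 6`; `−27`: `k = 0, 1`) — the double root they produce
  is used by the sequel, not here;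
* `D = −35` (`7` ramified, `𝔭₇` non-principal): `Φ₇(j(τ_{(3,1,3)}), j(τ_{(1,1,9)})) = 0` and its partner; `D = −112 = −7·4²`
  (order of conductor 4 in `ℚ(√−7)`, `𝔭₇` invertible and non-principal): `Φ₇(j(τ_{(4,0,7)}), j(τ_{(1,0,28)})) = 0` and its partner.
Together with `Φ₇(X, 0) = X²·H₋₁₄₇(X)³` (`ModularPolynomialLevelSevenFibreZero.lean`), the symmetry `κ_{m,n} = κ_{n,m}`
(`ModularPolynomialSymmetric.lean`) and the split class-number-two relations with their multiplicities, these relations determine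
`Φ₇` (lit note PHI7-SCOPE: rank 35/35) — the sequel and the solve are left to later files.

## References
* [Cox2013] D. A. Cox, *Primes of the form x² + ny²*, 2nd ed., Wiley (2013): §11.B (11.15) (p. 239), Lemma 11.24 (p. 243), §11.A Thm. 11.2,
  §7.B (7.8)–(7.9), §12.C table (12.20) (pp. 266–267).
* [Ishii2004] N. Ishii, class polynomials of class number two (§3, rows `d(R) = −35, −112`), as cited in the two tree files.
-/

noncomputable section

open Complex Polynomial
open UpperHalfPlane hiding I
open scoped MatrixGroups

namespace Literature.NumberTheory.EllipticCurves

open ModularForms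
open Literature.NumberTheory.QuadraticFields.Quadratic (BinQF)

namespace ModularPolynomialSeven

variable [Fact (Nat.Prime 7)]

/-! ### §1 The level-7 conjugates `(τ_Q + k)/7` that are Heegner points of the same discriminant -/

/-- `j((τ_{(1,1,2)} + 4)/7) = j(τ_{(49,−49,14)}) = j(τ_{(7,−7,2)}) = j(τ_{(1,1,2)})` (`D = −7`: `√−7/7·…`, the ramified prime `(√−7)` is principal).
[cite: Cox2013, §11.B Lemma 11.24 and §11.A Thm. 11.2] -/
theorem conj_4_neg7 : kleinJ (divPoint 7 4 (heegnerTau (1, 1, 2))) = -3375 := by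
  have h := divPoint_seven_heegnerTau_of_pos (a := 1) (b := 1) (c := 2) one_pos (by norm_num) 4
  norm_num at h
  have h7 := heegnerTau_seven_mul (a := 7) (b := -7) (c := 2) (by norm_num) (by norm_num)
  norm_num at h7
  rw [h, h7, ← formJ_eq_kleinJ, ← GrossZagier1985.kleinJ_heegnerTau_neg_seven, ← formJ_eq_kleinJ]
  have e := formJ_eq_formJ_act ⟨7, -7, 2⟩ (by norm_num) (by norm_num [BinQF.disc]) (p := -1) (q := 0)
    (r := -2) (s := -1) (by norm_num)
  simpa [BinQF.act] using e

/-- `j((τ_{(1,0,3)} + 2)/7) = j(τ_{(49,−28,7)}) = j(τ_{(7,−4,1)}) = j(τ_{(1,0,3)})` (`D = −12`, the endomorphism `2 + √−3` of degree 7).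
[cite: Cox2013, §11.B Lemma 11.24 and §11.A Thm. 11.2] -/
theorem conj_2_neg12 : kleinJ (divPoint 7 2 (heegnerTau (1, 0, 3))) = 54000 := by
  have h := divPoint_seven_heegnerTau_of_pos (a := 1) (b := 0) (c := 3) one_pos (by norm_num) 2
  norm_num at h
  have h7 := heegnerTau_seven_mul (a := 7) (b := -4) (c := 1) (by norm_num) (by norm_num)
  norm_num at h7
  rw [h, h7, ← formJ_eq_kleinJ, ← GrossZagier1985.kleinJ_heegnerTau_neg_twelve, ← formJ_eq_kleinJ]
  have e := formJ_eq_formJ_act ⟨7, -4, 1⟩ (by norm_num) (by norm_num [BinQF.disc]) (p := 0) (q := -1)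
    (r := 1) (s := -2) (by norm_num)
  simpa [BinQF.act] using e

/-- `j((τ_{(1,0,3)} + 5)/7) = j(τ_{(49,−70,28)}) = j(τ_{(7,−10,4)}) = j(τ_{(1,0,3)})` (`D = −12`, the endomorphism `2 − √−3`).
[cite: Cox2013, §11.B Lemma 11.24 and §11.A Thm. 11.2] -/
theorem conj_5_neg12 : kleinJ (divPoint 7 5 (heegnerTau (1, 0, 3))) = 54000 := by
  have h := divPoint_seven_heegnerTau_of_pos (a := 1) (b := 0) (c := 3) one_pos (by norm_num) 5
  norm_num at h
  have h7 := heegnerTau_seven_mul (a := 7) (b := -10) (c := 4) (by norm_num) (by norm_num)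
  norm_num at h7
  rw [h, h7, ← formJ_eq_kleinJ, ← GrossZagier1985.kleinJ_heegnerTau_neg_twelve, ← formJ_eq_kleinJ]
  have e := formJ_eq_formJ_act ⟨7, -10, 4⟩ (by norm_num) (by norm_num [BinQF.disc]) (p := -1) (q := -1)
    (r := -1) (s := -2) (by norm_num)
  simpa [BinQF.act] using e

/-- `j((τ_{(1,1,5)} + 2)/7) = j(τ_{(49,−21,7)}) = j(τ_{(7,−3,1)}) = j(τ_{(1,1,5)})` (`D = −19`, `7` splits in `ℚ(√−19)`).
[cite: Cox2013, §11.B Lemma 11.24 and §11.A Thm. 11.2] -/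
theorem conj_2_neg19 : kleinJ (divPoint 7 2 (heegnerTau (1, 1, 5))) = -884736 := by
  have h := divPoint_seven_heegnerTau_of_pos (a := 1) (b := 1) (c := 5) one_pos (by norm_num) 2
  norm_num at h
  have h7 := heegnerTau_seven_mul (a := 7) (b := -3) (c := 1) (by norm_num) (by norm_num)
  norm_num at h7
  rw [h, h7, ← formJ_eq_kleinJ, ← GrossZagier1985.kleinJ_heegnerTau_neg_nineteen, ← formJ_eq_kleinJ]
  have e := formJ_eq_formJ_act ⟨7, -3, 1⟩ (by norm_num) (by norm_num [BinQF.disc]) (p := 0) (q := -1)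
    (r := 1) (s := -1) (by norm_num)
  simpa [BinQF.act] using e

/-- `j((τ_{(1,1,5)} + 6)/7) = j(τ_{(49,−77,35)}) = j(τ_{(7,−11,5)}) = j(τ_{(1,1,5)})` (`D = −19`, the conjugate prime).
[cite: Cox2013, §11.B Lemma 11.24 and §11.A Thm. 11.2] -/
theorem conj_6_neg19 : kleinJ (divPoint 7 6 (heegnerTau (1, 1, 5))) = -884736 := by
  have h := divPoint_seven_heegnerTau_of_pos (a := 1) (b := 1) (c := 5) one_pos (by norm_num) 6
  norm_num at h
  have h7 := heegnerTau_seven_mul (a := 7) (b := -11) (c := 5) (by norm_num) (by norm_num)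
  norm_num at h7
  rw [h, h7, ← formJ_eq_kleinJ, ← GrossZagier1985.kleinJ_heegnerTau_neg_nineteen, ← formJ_eq_kleinJ]
  have e := formJ_eq_formJ_act ⟨7, -11, 5⟩ (by norm_num) (by norm_num [BinQF.disc]) (p := -1) (q := -1)
    (r := -1) (s := -2) (by norm_num)
  simpa [BinQF.act] using e

/-- `j(τ_{(1,1,7)}/7) = j(τ_{(49,7,7)}) = j(τ_{(7,1,1)}) = j(τ_{(1,1,7)})` (`D = −27`, `7` splits in the order `ℤ[3ρ]`).
[cite: Cox2013, §11.B Lemma 11.24 and §11.A Thm. 11.2] -/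
theorem conj_0_neg27 : kleinJ (divPoint 7 0 (heegnerTau (1, 1, 7))) = -12288000 := by
  have h := divPoint_seven_heegnerTau_of_pos (a := 1) (b := 1) (c := 7) one_pos (by norm_num) 0
  norm_num at h
  have h7 := heegnerTau_seven_mul (a := 7) (b := 1) (c := 1) (by norm_num) (by norm_num)
  norm_num at h7
  rw [h, h7, ← formJ_eq_kleinJ, ← GrossZagier1985.kleinJ_heegnerTau_neg_twentySeven, ← formJ_eq_kleinJ]
  have e := formJ_eq_formJ_act ⟨7, 1, 1⟩ (by norm_num) (by norm_num [BinQF.disc]) (p := 0) (q := -1)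
    (r := 1) (s := 1) (by norm_num)
  simpa [BinQF.act] using e

/-- `j((τ_{(1,1,7)} + 1)/7) = j(τ_{(49,−7,7)}) = j(τ_{(7,−1,1)}) = j(τ_{(1,1,7)})` (`D = −27`, the conjugate prime).
[cite: Cox2013, §11.B Lemma 11.24 and §11.A Thm. 11.2] -/
theorem conj_1_neg27 : kleinJ (divPoint 7 1 (heegnerTau (1, 1, 7))) = -12288000 := by
  have h := divPoint_seven_heegnerTau_of_pos (a := 1) (b := 1) (c := 7) one_pos (by norm_num) 1
  norm_num at h
  have h7 := heegnerTau_seven_mul (a := 7) (b := -1) (c := 1) (by norm_num) (by norm_num)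
  norm_num at h7
  rw [h, h7, ← formJ_eq_kleinJ, ← GrossZagier1985.kleinJ_heegnerTau_neg_twentySeven, ← formJ_eq_kleinJ]
  have e := formJ_eq_formJ_act ⟨7, -1, 1⟩ (by norm_num) (by norm_num [BinQF.disc]) (p := 0) (q := -1)
    (r := 1) (s := 0) (by norm_num)
  simpa [BinQF.act] using e

/-- `j(τ_{(1,0,7)}/7) = j(τ_{(49,0,7)}) = j(τ_{(7,0,1)}) = j(τ_{(1,0,7)})` (`D = −28`: the ramified prime `(√−7)` of `ℤ[√−7]` is principal).
[cite: Cox2013, §11.B Lemma 11.24 and §11.A Thm. 11.2] -/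
theorem conj_0_neg28 : kleinJ (divPoint 7 0 (heegnerTau (1, 0, 7))) = 16581375 := by
  have h := divPoint_seven_heegnerTau_of_pos (a := 1) (b := 0) (c := 7) one_pos (by norm_num) 0
  norm_num at h
  have h7 := heegnerTau_seven_mul (a := 7) (b := 0) (c := 1) (by norm_num) (by norm_num)
  norm_num at h7
  rw [h, h7, ← formJ_eq_kleinJ, ← GrossZagier1985.kleinJ_heegnerTau_neg_twentyEight, ← formJ_eq_kleinJ]
  have e := formJ_eq_formJ_act ⟨7, 0, 1⟩ (by norm_num) (by norm_num [BinQF.disc]) (p := 0) (q := -1)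
    (r := 1) (s := 0) (by norm_num)
  simpa [BinQF.act] using e

/-- `j((τ_{(1,1,9)} + 4)/7) = j(τ_{(49,−49,21)}) = j(τ_{(7,−7,3)}) = j(τ_{(3,1,3)})` (`D = −35`, the ramified prime over `7`).
[cite: Cox2013, §11.B Lemma 11.24 and §11.A Thm. 11.2] -/
theorem conj_4_neg35 : kleinJ (divPoint 7 4 (heegnerTau (1, 1, 9))) = formJ (3, 1, 3) := by
  have h := divPoint_seven_heegnerTau_of_pos (a := 1) (b := 1) (c := 9) one_pos (by norm_num) 4
  norm_num at h
  have h7 := heegnerTau_seven_mul (a := 7) (b := -7) (c := 3) (by norm_num) (by norm_num)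
  norm_num at h7
  rw [h, h7, ← formJ_eq_kleinJ]
  have e := formJ_eq_formJ_act ⟨7, -7, 3⟩ (by norm_num) (by norm_num [BinQF.disc]) (p := 0) (q := -1)
    (r := 1) (s := -1) (by norm_num)
  simpa [BinQF.act] using e

/-- `j((τ_{(3,1,3)} + 6)/7) = j(τ_{(147,−245,105)}) = j(τ_{(21,−35,15)}) = j(τ_{(1,1,9)})` (`D = −35`).
[cite: Cox2013, §11.B Lemma 11.24 and §11.A Thm. 11.2] -/
theorem conj_6_neg35' : kleinJ (divPoint 7 6 (heegnerTau (3, 1, 3))) = formJ (1, 1, 9) := by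
  have h := divPoint_seven_heegnerTau_of_pos (a := 3) (b := 1) (c := 3) (by norm_num) (by norm_num) 6
  norm_num at h
  have h7 := heegnerTau_seven_mul (a := 21) (b := -35) (c := 15) (by norm_num) (by norm_num)
  norm_num at h7
  rw [h, h7, ← formJ_eq_kleinJ]
  have e := formJ_eq_formJ_act ⟨21, -35, 15⟩ (by norm_num) (by norm_num [BinQF.disc]) (p := -1) (q := -3)
    (r := -1) (s := -4) (by norm_num)
  simpa [BinQF.act] using e

/-- `j(τ_{(1,0,28)}/7) = j(τ_{(49,0,28)}) = j(τ_{(7,0,4)}) = j(τ_{(4,0,7)})` (`D = −112`, the invertible ideal over the ramified `7`).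
[cite: Cox2013, §11.B Lemma 11.24 and §11.A Thm. 11.2] -/
theorem conj_0_neg112 : kleinJ (divPoint 7 0 (heegnerTau (1, 0, 28))) = formJ (4, 0, 7) := by
  have h := divPoint_seven_heegnerTau_of_pos (a := 1) (b := 0) (c := 28) one_pos (by norm_num) 0
  norm_num at h
  have h7 := heegnerTau_seven_mul (a := 7) (b := 0) (c := 4) (by norm_num) (by norm_num)
  norm_num at h7
  rw [h, h7, ← formJ_eq_kleinJ]
  have e := formJ_eq_formJ_act ⟨7, 0, 4⟩ (by norm_num) (by norm_num [BinQF.disc]) (p := 0) (q := -1)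
    (r := 1) (s := 0) (by norm_num)
  simpa [BinQF.act] using e

/-- `j(τ_{(4,0,7)}/7) = j(τ_{(196,0,7)}) = j(τ_{(28,0,1)}) = j(τ_{(1,0,28)})` (`D = −112`).
[cite: Cox2013, §11.B Lemma 11.24 and §11.A Thm. 11.2] -/
theorem conj_0_neg112' : kleinJ (divPoint 7 0 (heegnerTau (4, 0, 7))) = formJ (1, 0, 28) := by
  have h := divPoint_seven_heegnerTau_of_pos (a := 4) (b := 0) (c := 7) (by norm_num) (by norm_num) 0
  norm_num at h
  have h7 := heegnerTau_seven_mul (a := 28) (b := 0) (c := 1) (by norm_num) (by norm_num)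
  norm_num at h7
  rw [h, h7, ← formJ_eq_kleinJ]
  have e := formJ_eq_formJ_act ⟨28, 0, 1⟩ (by norm_num) (by norm_num [BinQF.disc]) (p := 0) (q := -1)
    (r := 1) (s := 0) (by norm_num)
  simpa [BinQF.act] using e

/-! ### §2 The CM relations `Φ₇(x₀, y₀) = 0`: five rational diagonal zeros, two conjugate pairs (moduli as atoms) -/

/-- **`Φ₇(−3375, −3375) = 0`** (`D = −7`). [cite: Cox2013, §11.B (11.15), §12.C (12.20)] -/
theorem rel_neg7 : (((intModularPolynomial 7).map (mapRingHom (Int.castRingHom ℂ))).map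
    (evalRingHom (-3375 : ℂ))).eval (-3375 : ℂ) = 0 := by
  have h := intModularPolynomial_kleinJ_divPoint 7 4 (heegnerTau (1, 1, 2))
  rwa [conj_4_neg7, GrossZagier1985.kleinJ_heegnerTau_neg_seven] at h

/-- **`Φ₇(54000, 54000) = 0`** (`D = −12`). [cite: Cox2013, §11.B (11.15), §12.C (12.20)] -/
theorem rel_neg12 : (((intModularPolynomial 7).map (mapRingHom (Int.castRingHom ℂ))).map
    (evalRingHom (54000 : ℂ))).eval (54000 : ℂ) = 0 := by
  have h := intModularPolynomial_kleinJ_divPoint 7 2 (heegnerTau (1, 0, 3))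
  rwa [conj_2_neg12, GrossZagier1985.kleinJ_heegnerTau_neg_twelve] at h

/-- **`Φ₇(−884736, −884736) = 0`** (`D = −19`). [cite: Cox2013, §11.B (11.15), §12.C (12.20)] -/
theorem rel_neg19 : (((intModularPolynomial 7).map (mapRingHom (Int.castRingHom ℂ))).map
    (evalRingHom (-884736 : ℂ))).eval (-884736 : ℂ) = 0 := by
  have h := intModularPolynomial_kleinJ_divPoint 7 2 (heegnerTau (1, 1, 5))
  rwa [conj_2_neg19, GrossZagier1985.kleinJ_heegnerTau_neg_nineteen] at h

/-- **`Φ₇(−12288000, −12288000) = 0`** (`D = −27`). [cite: Cox2013, §11.B (11.15), §12.C (12.20)] -/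
theorem rel_neg27 : (((intModularPolynomial 7).map (mapRingHom (Int.castRingHom ℂ))).map
    (evalRingHom (-12288000 : ℂ))).eval (-12288000 : ℂ) = 0 := by
  have h := intModularPolynomial_kleinJ_divPoint 7 0 (heegnerTau (1, 1, 7))
  rwa [conj_0_neg27, GrossZagier1985.kleinJ_heegnerTau_neg_twentySeven] at h

/-- **`Φ₇(16581375, 16581375) = 0`** (`D = −28`). [cite: Cox2013, §11.B (11.15), §12.C (12.20)] -/
theorem rel_neg28 : (((intModularPolynomial 7).map (mapRingHom (Int.castRingHom ℂ))).map
    (evalRingHom (16581375 : ℂ))).eval (16581375 : ℂ) = 0 := by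
  have h := intModularPolynomial_kleinJ_divPoint 7 0 (heegnerTau (1, 0, 7))
  rwa [conj_0_neg28, GrossZagier1985.kleinJ_heegnerTau_neg_twentyEight] at h

/-- **`Φ₇(j(τ_{(3, 1, 3)}), j(τ_{(1, 1, 9)})) = 0`** (`D = −35`), with the moduli as atoms `formJ`. [cite: Cox2013, §11.B (11.15) and Lemma 11.24] -/
theorem rel_neg35 : (((intModularPolynomial 7).map (mapRingHom (Int.castRingHom ℂ))).map
    (evalRingHom (formJ (1, 1, 9)))).eval (formJ (3, 1, 3)) = 0 := by
  have h := intModularPolynomial_kleinJ_divPoint 7 4 (heegnerTau (1, 1, 9))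
  rwa [conj_4_neg35, ← formJ_eq_kleinJ] at h

/-- **`Φ₇(j(τ_{(1, 1, 9)}), j(τ_{(3, 1, 3)})) = 0`** (`D = −35`), with the moduli as atoms `formJ`. [cite: Cox2013, §11.B (11.15) and Lemma 11.24] -/
theorem rel_neg35' : (((intModularPolynomial 7).map (mapRingHom (Int.castRingHom ℂ))).map
    (evalRingHom (formJ (3, 1, 3)))).eval (formJ (1, 1, 9)) = 0 := by
  have h := intModularPolynomial_kleinJ_divPoint 7 6 (heegnerTau (3, 1, 3))
  rwa [conj_6_neg35', ← formJ_eq_kleinJ] at h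

/-- **`Φ₇(j(τ_{(4, 0, 7)}), j(τ_{(1, 0, 28)})) = 0`** (`D = −112`), with the moduli as atoms `formJ`. [cite: Cox2013, §11.B (11.15) and Lemma 11.24] -/
theorem rel_neg112 : (((intModularPolynomial 7).map (mapRingHom (Int.castRingHom ℂ))).map
    (evalRingHom (formJ (1, 0, 28)))).eval (formJ (4, 0, 7)) = 0 := by
  have h := intModularPolynomial_kleinJ_divPoint 7 0 (heegnerTau (1, 0, 28))
  rwa [conj_0_neg112, ← formJ_eq_kleinJ] at h

/-- **`Φ₇(j(τ_{(1, 0, 28)}), j(τ_{(4, 0, 7)})) = 0`** (`D = −112`), with the moduli as atoms `formJ`. [cite: Cox2013, §11.B (11.15) and Lemma 11.24] -/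
theorem rel_neg112' : (((intModularPolynomial 7).map (mapRingHom (Int.castRingHom ℂ))).map
    (evalRingHom (formJ (4, 0, 7)))).eval (formJ (1, 0, 28)) = 0 := by
  have h := intModularPolynomial_kleinJ_divPoint 7 0 (heegnerTau (4, 0, 7))
  rwa [conj_0_neg112', ← formJ_eq_kleinJ] at h

/-! ### §3 The class-number-two relations with the printed values of the moduli substituted -/

/-- `Φ₇(j₂, j₁) = 0`, `D = −35`: `j₁ = j(τ_{(1,1,9)}) = −58982400 − 26378240√5`, `j₂ = j(τ_{(3,1,3)}) = −58982400 + 26378240√5`.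
[cite: Cox2013, §11.B (11.15); Ishii2004, §3 (row d(R) = −35)] -/
theorem rel_neg35_explicit : (((intModularPolynomial 7).map (mapRingHom (Int.castRingHom ℂ))).map
    (evalRingHom (-58982400 - 26378240 * (√(5 : ℝ) : ℂ)))).eval (-58982400 + 26378240 * (√(5 : ℝ) : ℂ)) = 0 := by
  rw [← ClassPolynomialNegThirtyFive.formJ_eq, ← ClassPolynomialNegThirtyFive.formJ_other_eq]
  exact rel_neg35

/-- `Φ₇(j₂, j₁) = 0`, `D = −112`: `j₁ = j(τ_{(1,0,28)}) = 137458661985000 + 51954490735875√7`, `j₂ = j(τ_{(4,0,7)}) = 137458661985000 − 51954490735875√7`.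
[cite: Cox2013, §11.B (11.15); Ishii2004, §3 (row d(R) = −112)] -/
theorem rel_neg112_explicit : (((intModularPolynomial 7).map (mapRingHom (Int.castRingHom ℂ))).map
    (evalRingHom (137458661985000 + 51954490735875 * (√(7 : ℝ) : ℂ)))).eval
      (137458661985000 - 51954490735875 * (√(7 : ℝ) : ℂ)) = 0 := by
  rw [← ClassPolynomialNegOneHundredTwelve.formJ_eq, ← ClassPolynomialNegOneHundredTwelve.formJ_other_eq]
  exact rel_neg112

end ModularPolynomialSeven
end Literature.NumberTheory.EllipticCurves
end
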